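import Summits.CriticalPhenomena.PercolationContinuityZ3.Theorems.PercNearOneGluingNoHeavyLowerTailFrontierDecRowsCutSetup
import Summits.CriticalPhenomena.PercolationContinuityZ3.Theorems.PercNearOneGluingNoHeavyLowerTailFrontierDecRowsCutMeasure
import Summits.CriticalPhenomena.PercolationContinuityZ3.Theorems.PercNearOneGluingNoHeavyLowerTailFrontierDecRowsClusterMarkov
import Mathlib.Tactic.Linarith
import HarnessLib

/-!
# Frontier dec row 15 `E₃(D[ab|c], D[ac|y], D[b|y])` across a cut vertex isolating the terminal `c`: one Harris bracket and row 26

Support file for crux `stmt-CriticalPhenomena-4575` (four-point decreasing `E₃` frontier), seat `prim-l12-p6` gen 16; memo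
`run/shared/lean/prim/prim-l12/FROM-prim-l12-p6-g16-ROW37-HUB-IDENTITY.md` §3.  No definitions, no named facts, no sorries.

Row 15 across a cut vertex `h` separating `c` (colour `false`) from `a, b, y` (colour `true`); `ρ = P(h ↔ c on the far side)`.  Only `D[ab|c]`
and `D[ac|y]` see the far side, so Sahi's functional is QUADRATIC in `ρ`.  Near-side events: `Ay = {a≁y}`, `Bz = {b≁y}`, `U = {a↔h} ∪ {b↔h}`
(`= D[ab|h]ᶜ`), `Hy = {y↔h}`, `W = U ∪ Hy` (`= D[aby|h]ᶜ`), `T = Ay ∩ Bz ∩ Hy` (`= Hy ∖ U`).  Glued: `D[ab|c] = (U ∧ C)ᶜ`, `D[ac|y] = Ay ∖ (Hy ∧ C)`,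
`D[b|y] = Bz`, and EXACTLY (symbolic identity over the 15 cells of the near-side law; found from an LP certificate, kit j150744)
  **`E₃ = (1−ρ)²·Cov(Ay,Bz) + ρ(1−ρ)·[Cov(Ay,Bz) + row 26 at (y,a,b,h) + P(T)·(P(Bz ∖ Ay) + P(Ayᶜ)·P(Bzᶜ))] + ρ²·row 15 at (a,b,h,y)`**,
row 26 `(D[abc|y], D[a|b], D[a|c])` being a kernel theorem for every `n` (`frontier_26_all`, cluster-Markov criterion).
THEOREM (`sahiE3_row15_nonneg_of_threeOneCut_c`): row 15 at `(a,b,h,y)` implies row 15 at `(a,b,c,y)` across such a cut.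
-/

noncomputable section

namespace Summit.CriticalPhenomena.PercolationContinuityZ3.Theorems.FrontierDecRows

open MeasureTheory CovTransferCert E3GroupSepCert
open Literature.Probability.Percolation Literature.Probability.LatticeModels

variable {n : ℕ}

/-- The row-15 lone-`c` pencil in real variables (`r = P(h ↔ c)`; `u = P(U)`, `w = P(W)`, `ay = P(Ay)`, `bz = P(Bz)`, joint masses as named,
`abHy = P(T)`). [this work] -/
theorem row15_threeOneCutC_ineq (r u w ay bz aybz ayHy ayW bzU bzW abHy abW : ℝ) (hr0 : 0 ≤ r) (hr1 : r ≤ 1)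
    (hay1 : ay ≤ 1) (hbz1 : bz ≤ 1) (hT : 0 ≤ abHy) (hmono : aybz ≤ bz) (hw : w = u + abHy) (hbzW : bzW = bzU + abHy)
    (H3 : ay * bz ≤ aybz)
    (h26 : 0 ≤ 2 * (aybz - abW) + (1 - w) * ay * bz - ((1 - w) * aybz + ay * (bz - bzW) + bz * (ay - ayW)))
    (h15 : 0 ≤ 2 * (aybz - abW) + (1 - u) * (ay - ayHy) * bz - ((1 - u) * (aybz - abHy) + (ay - ayHy) * (bz - bzU) + bz * (ay - ayW))) :
    0 ≤ 2 * (aybz - abW * r) + (1 - u * r) * (ay - ayHy * r) * bz -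
      ((1 - u * r) * (aybz - abHy * r) + (ay - ayHy * r) * (bz - bzU * r) + bz * (ay - ayW * r)) := by
  subst hw hbzW
  have key : 2 * (aybz - abW * r) + (1 - u * r) * (ay - ayHy * r) * bz -
      ((1 - u * r) * (aybz - abHy * r) + (ay - ayHy * r) * (bz - bzU * r) + bz * (ay - ayW * r)) =
      (1 - r) ^ 2 * (aybz - ay * bz) +
      r * (1 - r) * ((aybz - ay * bz) + (2 * (aybz - abW) + (1 - (u + abHy)) * ay * bz -
          ((1 - (u + abHy)) * aybz + ay * (bz - (bzU + abHy)) + bz * (ay - ayW))) + abHy * ((bz - aybz) + (1 - ay) * (1 - bz))) +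
      r ^ 2 * (2 * (aybz - abW) + (1 - u) * (ay - ayHy) * bz - ((1 - u) * (aybz - abHy) + (ay - ayHy) * (bz - bzU) + bz * (ay - ayW))) := by
    ring
  rw [key]
  have h1r : 0 ≤ 1 - r := sub_nonneg.2 hr1
  have t1 := mul_nonneg (sq_nonneg (1 - r)) (sub_nonneg.2 H3)
  have tT : 0 ≤ abHy * ((bz - aybz) + (1 - ay) * (1 - bz)) :=
    mul_nonneg hT (add_nonneg (sub_nonneg.2 hmono) (mul_nonneg (sub_nonneg.2 hay1) (sub_nonneg.2 hbz1)))
  have t2 : 0 ≤ (aybz - ay * bz) + (2 * (aybz - abW) + (1 - (u + abHy)) * ay * bz -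
      ((1 - (u + abHy)) * aybz + ay * (bz - (bzU + abHy)) + bz * (ay - ayW))) + abHy * ((bz - aybz) + (1 - ay) * (1 - bz)) := by
    linarith [sub_nonneg.2 H3]
  have t3 := mul_nonneg (mul_nonneg hr0 h1r) t2
  have t4 := mul_nonneg (sq_nonneg r) h15
  linarith

set_option maxHeartbeats 1600000 in
/-- **Row 15 across a cut vertex isolating `c`.**  `a, b, y` coloured `true`, `c` coloured `false`, every positive-weight edge avoiding `h`
monochromatic: row 15 at `(a,b,h,y)` implies row 15 at `(a,b,c,y)` (quadratic pencil; Harris + row 26 + trivial terms + IH). [this work] -/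
theorem sahiE3_row15_nonneg_of_threeOneCut_c (w : Sym2 (Fin n) → unitInterval) (a b c y h : Fin n) (side : Fin n → Bool)
    (ha : side a = true) (hb : side b = true) (hy : side y = true) (hc : side c = false)
    (hw : ∀ u v : Fin n, u ≠ h → v ≠ h → side u ≠ side v → w s(u, v) = 0)
    (h15 : 0 ≤ sahiE3 (prodBernoulli w) (connEvent (row 15 n (a, b, h, y)).1) (connEvent (row 15 n (a, b, h, y)).2.1)
      (connEvent (row 15 n (a, b, h, y)).2.2)) :
    0 ≤ sahiE3 (prodBernoulli w) (connEvent (row 15 n (a, b, c, y)).1) (connEvent (row 15 n (a, b, c, y)).2.1)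
      (connEvent (row 15 n (a, b, c, y)).2.2) := by
  classical
  have h26 := frontier_26_all w y a b h
  have hrow : row 15 n (a, b, c, y) = (sep [a, b] [c], sep [a, c] [y], sep [b] [y]) := rfl
  have hrow' : row 15 n (a, b, h, y) = (sep [a, b] [h], sep [a, h] [y], sep [b] [y]) := rfl
  have hrow26 : row 26 n (y, a, b, h) = (sep [y, a, b] [h], sep [y] [a], sep [y] [b]) := rfl
  simp only [hrow, connEvent_sep]
  simp only [hrow', connEvent_sep] at h15
  simp only [hrow26, connEvent_sep] at h26
  set μ := prodBernoulli w with hμ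
  have neC : ∀ x, side x = true → x ≠ c := fun x hx e => by rw [e, hc] at hx; exact Bool.false_ne_true hx
  obtain ⟨hac, hbc, hyc⟩ : a ≠ c ∧ b ≠ c ∧ y ≠ c := ⟨neC a ha, neC b hb, neC y hy⟩
  set F₁ : Finset (Sym2 (Fin n)) := Finset.univ.filter (fun e => ∀ u ∈ e, side u = true ∨ u = h) with hF₁
  set F₂ : Finset (Sym2 (Fin n)) :=
    Finset.univ.filter (fun e => (∀ u ∈ e, side u = false ∨ u = h) ∧ ¬ ∀ u ∈ e, u = h) with hF₂
  have hdisj : Disjoint F₁ F₂ := cutSides_disjoint side h F₁ F₂ hF₁ hF₂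
  set D : Finset (Sym2 (Fin n)) := F₁ ∪ F₂ with hD
  have hwD : ∀ e, e ∉ D → w e = 0 := fun e he => cutSides_weight_zero w side h F₁ F₂ hF₁ hF₂ hw e (by rwa [hD] at he)
  have pl : ∀ ω : Set (Sym2 (Fin n)), ∀ x z, side x = true → side z = true →
      ((openGraph (ω ∩ ↑D)).Reachable x z ↔ (openGraph (ω ∩ ↑F₁)).Reachable x z) := by
    intro ω x z hx hz; rw [hD]; exact cutSides_reach_left side h F₁ F₂ hF₁ hF₂ ω x z hx hz
  have plh : ∀ ω : Set (Sym2 (Fin n)), ∀ x, side x = true →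
      ((openGraph (ω ∩ ↑D)).Reachable x h ↔ (openGraph (ω ∩ ↑F₁)).Reachable x h) := by
    intro ω x hx; rw [hD]; exact cutSides_reach_h side h F₁ F₂ hF₁ hF₂ ω x hx
  have pc : ∀ ω : Set (Sym2 (Fin n)), ∀ x, side x = true → x ≠ c →
      ((openGraph (ω ∩ ↑D)).Reachable x c ↔
        (openGraph (ω ∩ ↑F₁)).Reachable x h ∧ (openGraph (ω ∩ ↑F₂)).Reachable h c) := by
    intro ω x hx hxc; rw [hD, SimpleGraph.reachable_comm]; exact cutSides_reach_cross side h F₁ F₂ hF₁ hF₂ ω x c hx hc hxc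
  -- near-side events
  set Ay : Set (Set (Sym2 (Fin n))) := {ω | ω ∩ ↑F₁ ∈ ((openConn a y)ᶜ : Set (Set (Sym2 (Fin n))))} with hAy
  set Bz : Set (Set (Sym2 (Fin n))) := {ω | ω ∩ ↑F₁ ∈ ((openConn b y)ᶜ : Set (Set (Sym2 (Fin n))))} with hBz
  set Hha : Set (Set (Sym2 (Fin n))) := {ω | ω ∩ ↑F₁ ∈ (openConn a h : Set (Set (Sym2 (Fin n))))} with hHha
  set Hhb : Set (Set (Sym2 (Fin n))) := {ω | ω ∩ ↑F₁ ∈ (openConn b h : Set (Set (Sym2 (Fin n))))} with hHhb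
  set Hy : Set (Set (Sym2 (Fin n))) := {ω | ω ∩ ↑F₁ ∈ (openConn y h : Set (Set (Sym2 (Fin n))))} with hHy
  set EC : Set (Set (Sym2 (Fin n))) := {ω | ω ∩ ↑F₂ ∈ (openConn h c : Set (Set (Sym2 (Fin n))))} with hEC
  set X : Set (Set (Sym2 (Fin n))) := {ω | ∀ x ∈ [a, b], ∀ z ∈ [c], ω ∉ openConn x z} with hX
  set Y : Set (Set (Sym2 (Fin n))) := {ω | ∀ x ∈ [a, c], ∀ z ∈ [y], ω ∉ openConn x z} with hY
  set Zg : Set (Set (Sym2 (Fin n))) := {ω | ∀ x ∈ [b], ∀ z ∈ [y], ω ∉ openConn x z} with hZg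
  have tX : {ω : Set (Sym2 (Fin n)) | ω ∩ ↑D ∈ X} = ((Hha ∪ Hhb) ∩ EC)ᶜ := by
    ext ω
    simp only [hX, hHha, hHhb, hEC, Set.mem_setOf_eq, Set.mem_compl_iff, Set.mem_inter_iff, Set.mem_union, openConn, List.mem_cons,
      List.mem_nil_iff, or_false, forall_eq_or_imp, forall_eq]
    rw [pc ω a ha hac, pc ω b hb hbc]
    tauto
  have tY : {ω : Set (Sym2 (Fin n)) | ω ∩ ↑D ∈ Y} = Ay \ ((Ay ∩ Hy) ∩ EC) := by
    ext ω
    simp only [hY, hAy, hHy, hEC, Set.mem_setOf_eq, Set.mem_sdiff, Set.mem_inter_iff, Set.mem_compl_iff, openConn, List.mem_cons,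
      List.mem_nil_iff, or_false, forall_eq_or_imp, forall_eq]
    rw [pl ω a y ha hy, SimpleGraph.reachable_comm (u := c), pc ω y hy hyc]
    tauto
  have tZ : {ω : Set (Sym2 (Fin n)) | ω ∩ ↑D ∈ Zg} = Bz := by
    ext ω
    simp only [hZg, hBz, Set.mem_setOf_eq, Set.mem_compl_iff, openConn, List.mem_singleton, forall_eq]
    exact not_congr (pl ω b y hb hy)
  -- hypothesis events: row 15 at (a,b,h,y) = (Uᶜ, Ay ∩ Hyᶜ, Bz); row 26 at (y,a,b,h) = (Wᶜ, Ay', Bz')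
  set Sabh : Set (Set (Sym2 (Fin n))) := {ω | ∀ p ∈ [a, b], ∀ q ∈ [h], ω ∉ openConn p q} with hSabh
  set Sahy : Set (Set (Sym2 (Fin n))) := {ω | ∀ p ∈ [a, h], ∀ q ∈ [y], ω ∉ openConn p q} with hSahy
  set Syabh : Set (Set (Sym2 (Fin n))) := {ω | ∀ p ∈ [y, a, b], ∀ q ∈ [h], ω ∉ openConn p q} with hSyabh
  set Sya : Set (Set (Sym2 (Fin n))) := {ω | ∀ p ∈ [y], ∀ q ∈ [a], ω ∉ openConn p q} with hSya
  set Syb : Set (Set (Sym2 (Fin n))) := {ω | ∀ p ∈ [y], ∀ q ∈ [b], ω ∉ openConn p q} with hSyb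
  have tU : {ω : Set (Sym2 (Fin n)) | ω ∩ ↑D ∈ Sabh} = (Hha ∪ Hhb)ᶜ := by
    ext ω
    simp only [hSabh, hHha, hHhb, Set.mem_setOf_eq, Set.mem_compl_iff, Set.mem_union, openConn, List.mem_cons, List.mem_nil_iff, or_false,
      forall_eq_or_imp, forall_eq]
    rw [plh ω a ha, plh ω b hb]
    tauto
  have tAH : {ω : Set (Sym2 (Fin n)) | ω ∩ ↑D ∈ Sahy} = Ay ∩ Hyᶜ := by
    ext ω
    simp only [hSahy, hAy, hHy, Set.mem_setOf_eq, Set.mem_inter_iff, Set.mem_compl_iff, openConn, List.mem_cons, List.mem_nil_iff, or_false,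
      forall_eq_or_imp, forall_eq]
    rw [pl ω a y ha hy, SimpleGraph.reachable_comm (u := h), plh ω y hy]
  have tW : {ω : Set (Sym2 (Fin n)) | ω ∩ ↑D ∈ Syabh} = (Hha ∪ Hhb ∪ Hy)ᶜ := by
    ext ω
    simp only [hSyabh, hHha, hHhb, hHy, Set.mem_setOf_eq, Set.mem_compl_iff, Set.mem_union, openConn, List.mem_cons, List.mem_nil_iff,
      or_false, forall_eq_or_imp, forall_eq]
    rw [plh ω y hy, plh ω a ha, plh ω b hb]
    tauto
  have tYA : {ω : Set (Sym2 (Fin n)) | ω ∩ ↑D ∈ Sya} = Ay := by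
    ext ω
    simp only [hSya, hAy, Set.mem_setOf_eq, Set.mem_compl_iff, openConn, List.mem_singleton, forall_eq]
    rw [SimpleGraph.reachable_comm]; exact not_congr (pl ω a y ha hy)
  have tYB : {ω : Set (Sym2 (Fin n)) | ω ∩ ↑D ∈ Syb} = Bz := by
    ext ω
    simp only [hSyb, hBz, Set.mem_setOf_eq, Set.mem_compl_iff, openConn, List.mem_singleton, forall_eq]
    rw [SimpleGraph.reachable_comm]; exact not_congr (pl ω b y hb hy)
  have thin : ∀ S : Set (Set (Sym2 (Fin n))), μ.real S = μ.real {ω | ω ∩ ↑D ∈ S} :=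
    fun S => real_eq_real_setOf_inter_mem w D hwD S
  have pre_inter : ∀ P Q : Set (Set (Sym2 (Fin n))),
      {ω : Set (Sym2 (Fin n)) | ω ∩ ↑D ∈ P ∩ Q} = {ω | ω ∩ ↑D ∈ P} ∩ {ω | ω ∩ ↑D ∈ Q} := fun P Q => rfl
  have ms : ∀ S : Set (Set (Sym2 (Fin n))), MeasurableSet S := fun S => (Set.toFinite _).measurableSet
  have detC : DeterminedBy EC (↑F₁ : Set (Sym2 (Fin n)))ᶜ := by
    rw [determinedBy_iff]
    intro ω ω' hω
    have hsub : (↑F₂ : Set (Sym2 (Fin n))) ⊆ (↑F₁ : Set (Sym2 (Fin n)))ᶜ := fun e he he1 =>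
      Finset.disjoint_left.1 hdisj (Finset.mem_coe.1 he1) (Finset.mem_coe.1 he)
    have : ω ∩ ↑F₂ = ω' ∩ ↑F₂ := by
      rw [← Set.inter_eq_self_of_subset_right hsub, ← Set.inter_assoc, ← Set.inter_assoc, hω]
    simp only [hEC, Set.mem_setOf_eq, this]
  have indep : ∀ S : Set (Set (Sym2 (Fin n))), (∀ ω ω' : Set (Sym2 (Fin n)), ω ∩ ↑F₁ = ω' ∩ ↑F₁ → (ω ∈ S ↔ ω' ∈ S)) →
      μ.real (S ∩ EC) = μ.real S * μ.real EC :=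
    fun S hS => prodBernoulli_real_inter_of_determinedBy w F₁ ((determinedBy_iff S _).2 hS) detC (ms _) (ms _)
  have sd : ∀ S : Set (Set (Sym2 (Fin n))), (∃ P : Set (Set (Sym2 (Fin n))), S = {ω | ω ∩ ↑F₁ ∈ P}) →
      ∀ ω ω' : Set (Sym2 (Fin n)), ω ∩ ↑F₁ = ω' ∩ ↑F₁ → (ω ∈ S ↔ ω' ∈ S) := by
    rintro S ⟨P, rfl⟩ ω ω' hω; simp only [Set.mem_setOf_eq, hω]
  have mC : ∀ S H : Set (Set (Sym2 (Fin n))), μ.real (S ∩ Hᶜ) = μ.real S - μ.real (S ∩ H) := real_inter_compl μ ms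
  have cpl : ∀ S : Set (Set (Sym2 (Fin n))), μ.real Sᶜ = 1 - μ.real S := by
    intro S; rw [Set.compl_eq_univ_sdiff, measureReal_sdiff (Set.subset_univ _) (ms _)]; simp [hμ]
  -- glued probabilities (`U = Hha ∪ Hhb`, `W = U ∪ Hy`)
  have eX : μ.real X = 1 - μ.real (Hha ∪ Hhb) * μ.real EC := by
    rw [thin, tX, cpl, indep (Hha ∪ Hhb) (fun ω ω' hω => by simp only [hHha, hHhb, Set.mem_union, Set.mem_setOf_eq, hω])]
  have eY : μ.real Y = μ.real Ay - μ.real (Ay ∩ Hy) * μ.real EC := by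
    rw [thin, tY]; exact real_sdiff_block₁ μ ms Ay Hy EC (indep _ (sd _ ⟨(openConn a y)ᶜ ∩ openConn y h, rfl⟩))
  have eZ : μ.real Zg = μ.real Bz := by rw [thin, tZ]
  have eXY : μ.real (X ∩ Y) = μ.real Ay - μ.real (Ay ∩ (Hha ∪ Hhb ∪ Hy)) * μ.real EC := by
    rw [thin, pre_inter, tX, tY]
    have e : ((Hha ∪ Hhb) ∩ EC)ᶜ ∩ (Ay \ ((Ay ∩ Hy) ∩ EC)) = Ay \ ((Ay ∩ (Hha ∪ Hhb ∪ Hy)) ∩ EC) := by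
      ext ω; simp only [Set.mem_sdiff, Set.mem_inter_iff, Set.mem_compl_iff, Set.mem_union]; tauto
    rw [e]; exact real_sdiff_block₁ μ ms Ay _ EC (indep _ (sd _ ⟨(openConn a y)ᶜ ∩ (openConn a h ∪ openConn b h ∪ openConn y h), rfl⟩))
  have eXZ : μ.real (X ∩ Zg) = μ.real Bz - μ.real (Bz ∩ (Hha ∪ Hhb)) * μ.real EC := by
    rw [thin, pre_inter, tX, tZ]
    have e : ((Hha ∪ Hhb) ∩ EC)ᶜ ∩ Bz = Bz \ ((Bz ∩ (Hha ∪ Hhb)) ∩ EC) := by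
      ext ω; simp only [Set.mem_sdiff, Set.mem_inter_iff, Set.mem_compl_iff, Set.mem_union]; tauto
    rw [e]; exact real_sdiff_block₁ μ ms Bz _ EC (indep _ (sd _ ⟨(openConn b y)ᶜ ∩ (openConn a h ∪ openConn b h), rfl⟩))
  have eYZ : μ.real (Y ∩ Zg) = μ.real (Ay ∩ Bz) - μ.real (Ay ∩ Bz ∩ Hy) * μ.real EC := by
    rw [thin, pre_inter, tY, tZ]
    have e : Ay \ ((Ay ∩ Hy) ∩ EC) ∩ Bz = (Ay ∩ Bz) \ (((Ay ∩ Bz) ∩ Hy) ∩ EC) := by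
      ext ω; simp only [Set.mem_sdiff, Set.mem_inter_iff]; tauto
    rw [e]; exact real_sdiff_block₁ μ ms _ Hy EC (indep _ (sd _ ⟨(openConn a y)ᶜ ∩ (openConn b y)ᶜ ∩ openConn y h, rfl⟩))
  have eXYZ : μ.real (X ∩ Y ∩ Zg) = μ.real (Ay ∩ Bz) - μ.real (Ay ∩ Bz ∩ (Hha ∪ Hhb ∪ Hy)) * μ.real EC := by
    rw [thin, pre_inter, pre_inter, tX, tY, tZ]
    have e : ((Hha ∪ Hhb) ∩ EC)ᶜ ∩ (Ay \ ((Ay ∩ Hy) ∩ EC)) ∩ Bz = (Ay ∩ Bz) \ (((Ay ∩ Bz) ∩ (Hha ∪ Hhb ∪ Hy)) ∩ EC) := by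
      ext ω; simp only [Set.mem_sdiff, Set.mem_inter_iff, Set.mem_compl_iff, Set.mem_union]; tauto
    rw [e]; exact real_sdiff_block₁ μ ms _ _ EC
      (indep _ (sd _ ⟨(openConn a y)ᶜ ∩ (openConn b y)ᶜ ∩ (openConn a h ∪ openConn b h ∪ openConn y h), rfl⟩))
  -- translate the hypotheses
  have m1 : ∀ P S : Set (Set (Sym2 (Fin n))), {ω : Set (Sym2 (Fin n)) | ω ∩ ↑D ∈ P} = S → μ.real P = μ.real S := by
    intro P S hPS; rw [thin, hPS]
  rw [sahiE3_def] at h15 h26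
  have v0 : μ.real (Sabh ∩ Sahy ∩ Zg) = μ.real ((Hha ∪ Hhb)ᶜ ∩ (Ay ∩ Hyᶜ) ∩ Bz) := m1 _ _ (by rw [pre_inter, pre_inter, tU, tAH, tZ])
  have v1 : μ.real Sabh = μ.real (Hha ∪ Hhb)ᶜ := m1 _ _ tU
  have v2 : μ.real Sahy = μ.real (Ay ∩ Hyᶜ) := m1 _ _ tAH
  have v3 : μ.real Zg = μ.real Bz := m1 _ _ tZ
  have v4 : μ.real (Sahy ∩ Zg) = μ.real ((Ay ∩ Hyᶜ) ∩ Bz) := m1 _ _ (by rw [pre_inter, tAH, tZ])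
  have v5 : μ.real (Sabh ∩ Zg) = μ.real ((Hha ∪ Hhb)ᶜ ∩ Bz) := m1 _ _ (by rw [pre_inter, tU, tZ])
  have v6 : μ.real (Sabh ∩ Sahy) = μ.real ((Hha ∪ Hhb)ᶜ ∩ (Ay ∩ Hyᶜ)) := m1 _ _ (by rw [pre_inter, tU, tAH])
  rw [v0, v1, v2, v3, v4, v5, v6] at h15
  have u0 : μ.real (Syabh ∩ Sya ∩ Syb) = μ.real ((Hha ∪ Hhb ∪ Hy)ᶜ ∩ Ay ∩ Bz) := m1 _ _ (by rw [pre_inter, pre_inter, tW, tYA, tYB])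
  have u1 : μ.real Syabh = μ.real (Hha ∪ Hhb ∪ Hy)ᶜ := m1 _ _ tW
  have u2 : μ.real Sya = μ.real Ay := m1 _ _ tYA
  have u3 : μ.real Syb = μ.real Bz := m1 _ _ tYB
  have u4 : μ.real (Sya ∩ Syb) = μ.real (Ay ∩ Bz) := m1 _ _ (by rw [pre_inter, tYA, tYB])
  have u5 : μ.real (Syabh ∩ Syb) = μ.real ((Hha ∪ Hhb ∪ Hy)ᶜ ∩ Bz) := m1 _ _ (by rw [pre_inter, tW, tYB])
  have u6 : μ.real (Syabh ∩ Sya) = μ.real ((Hha ∪ Hhb ∪ Hy)ᶜ ∩ Ay) := m1 _ _ (by rw [pre_inter, tW, tYA])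
  rw [u0, u1, u2, u3, u4, u5, u6] at h26
  -- set inputs: `T = Ay ∩ Bz ∩ Hy = Hy ∖ U`, disjoint from `U`
  have hT : ∀ ω, ω ∈ Hy → ((ω ∈ Ay ∧ ω ∈ Bz) ↔ ω ∉ Hha ∪ Hhb) := by
    intro ω hhy
    simp only [hAy, hBz, hHha, hHhb, hHy, Set.mem_setOf_eq, Set.mem_compl_iff, Set.mem_union, openConn, not_or] at hhy ⊢
    constructor
    · rintro ⟨hay, hby⟩; exact ⟨fun hah => hay (hah.trans hhy.symm), fun hbh => hby (hbh.trans hhy.symm)⟩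
    · rintro ⟨hah, hbh⟩; exact ⟨fun hay => hah (hay.trans hhy), fun hby => hbh (hby.trans hhy)⟩
  have sW : μ.real (Hha ∪ Hhb ∪ Hy) = μ.real (Hha ∪ Hhb) + μ.real (Ay ∩ Bz ∩ Hy) := by
    have e : Hha ∪ Hhb ∪ Hy = (Hha ∪ Hhb) ∪ (Ay ∩ Bz ∩ Hy) := by
      ext ω; simp only [Set.mem_union, Set.mem_inter_iff]
      constructor
      · rintro (hU | hhy)
        · exact Or.inl hU
        · by_cases hU : ω ∈ Hha ∪ Hhb
          · exact Or.inl (by simpa only [Set.mem_union] using hU)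
          · exact Or.inr ⟨(hT ω hhy).2 hU, hhy⟩
      · rintro (hU | ⟨_, hhy⟩)
        · exact Or.inl hU
        · exact Or.inr hhy
    have hd : Disjoint (Hha ∪ Hhb) (Ay ∩ Bz ∩ Hy) :=
      Set.disjoint_left.2 fun ω hU hTω => ((hT ω hTω.2).1 hTω.1) hU
    rw [e, measureReal_union hd (ms _)]
  have sBW : μ.real (Bz ∩ (Hha ∪ Hhb ∪ Hy)) = μ.real (Bz ∩ (Hha ∪ Hhb)) + μ.real (Ay ∩ Bz ∩ Hy) := by
    have e : Bz ∩ (Hha ∪ Hhb ∪ Hy) = (Bz ∩ (Hha ∪ Hhb)) ∪ (Ay ∩ Bz ∩ Hy) := by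
      ext ω; simp only [Set.mem_union, Set.mem_inter_iff]
      constructor
      · rintro ⟨hbz, hU | hhy⟩
        · exact Or.inl ⟨hbz, hU⟩
        · by_cases hU : ω ∈ Hha ∪ Hhb
          · exact Or.inl ⟨hbz, by simpa only [Set.mem_union] using hU⟩
          · exact Or.inr ⟨⟨((hT ω hhy).2 hU).1, hbz⟩, hhy⟩
      · rintro (⟨hbz, hU⟩ | ⟨⟨_, hbz⟩, hhy⟩)
        · exact ⟨hbz, Or.inl hU⟩
        · exact ⟨hbz, Or.inr hhy⟩
    have hd : Disjoint (Bz ∩ (Hha ∪ Hhb)) (Ay ∩ Bz ∩ Hy) :=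
      Set.disjoint_left.2 fun ω hU hTω => ((hT ω hTω.2).1 hTω.1) (by simpa only [Set.mem_union] using hU.2)
    rw [e, measureReal_union hd (ms _)]
  -- rewrite the hypotheses into the variables
  have sU1 : μ.real (Hha ∪ Hhb)ᶜ = 1 - μ.real (Hha ∪ Hhb) := cpl _
  have sW1 : μ.real (Hha ∪ Hhb ∪ Hy)ᶜ = 1 - μ.real (Hha ∪ Hhb ∪ Hy) := cpl _
  have sAH : μ.real (Ay ∩ Hyᶜ) = μ.real Ay - μ.real (Ay ∩ Hy) := mC _ _
  have s0 : μ.real ((Hha ∪ Hhb)ᶜ ∩ (Ay ∩ Hyᶜ) ∩ Bz) = μ.real (Ay ∩ Bz) - μ.real (Ay ∩ Bz ∩ (Hha ∪ Hhb ∪ Hy)) := by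
    have e : (Hha ∪ Hhb)ᶜ ∩ (Ay ∩ Hyᶜ) ∩ Bz = (Ay ∩ Bz) ∩ (Hha ∪ Hhb ∪ Hy)ᶜ := by
      ext ω; simp only [Set.mem_inter_iff, Set.mem_compl_iff, Set.mem_union]; tauto
    rw [e, mC]
  have s4 : μ.real ((Ay ∩ Hyᶜ) ∩ Bz) = μ.real (Ay ∩ Bz) - μ.real (Ay ∩ Bz ∩ Hy) := by
    have e : (Ay ∩ Hyᶜ) ∩ Bz = (Ay ∩ Bz) ∩ Hyᶜ := by ext ω; simp only [Set.mem_inter_iff, Set.mem_compl_iff]; tauto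
    rw [e, mC]
  have s5 : μ.real ((Hha ∪ Hhb)ᶜ ∩ Bz) = μ.real Bz - μ.real (Bz ∩ (Hha ∪ Hhb)) := by rw [Set.inter_comm, mC]
  have s6 : μ.real ((Hha ∪ Hhb)ᶜ ∩ (Ay ∩ Hyᶜ)) = μ.real Ay - μ.real (Ay ∩ (Hha ∪ Hhb ∪ Hy)) := by
    have e : (Hha ∪ Hhb)ᶜ ∩ (Ay ∩ Hyᶜ) = Ay ∩ (Hha ∪ Hhb ∪ Hy)ᶜ := by
      ext ω; simp only [Set.mem_inter_iff, Set.mem_compl_iff, Set.mem_union]; tauto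
    rw [e, mC]
  rw [s0, sU1, sAH, s4, s5, s6] at h15
  have w0 : μ.real ((Hha ∪ Hhb ∪ Hy)ᶜ ∩ Ay ∩ Bz) = μ.real (Ay ∩ Bz) - μ.real (Ay ∩ Bz ∩ (Hha ∪ Hhb ∪ Hy)) := by
    have e : (Hha ∪ Hhb ∪ Hy)ᶜ ∩ Ay ∩ Bz = (Ay ∩ Bz) ∩ (Hha ∪ Hhb ∪ Hy)ᶜ := by
      ext ω; simp only [Set.mem_inter_iff, Set.mem_compl_iff]; tauto
    rw [e, mC]
  have w5 : μ.real ((Hha ∪ Hhb ∪ Hy)ᶜ ∩ Bz) = μ.real Bz - μ.real (Bz ∩ (Hha ∪ Hhb ∪ Hy)) := by rw [Set.inter_comm, mC]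
  have w6 : μ.real ((Hha ∪ Hhb ∪ Hy)ᶜ ∩ Ay) = μ.real Ay - μ.real (Ay ∩ (Hha ∪ Hhb ∪ Hy)) := by rw [Set.inter_comm, mC]
  rw [w0, sW1, w5, w6] at h26
  -- Harris and trivial inputs
  have loConn : ∀ u v : Fin n, IsLowerSet {ω : Set (Sym2 (Fin n)) | ω ∩ ↑F₁ ∈ ((openConn u v)ᶜ : Set (Set (Sym2 (Fin n))))} := by
    intro u v ω ω' hle hω
    simp only [Set.mem_setOf_eq, Set.mem_compl_iff] at hω ⊢
    exact fun h' => hω (isUpperSet_openConn u v (Set.inter_subset_inter_left _ hle) h')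
  have H3 := prodBernoulli_harris_lower w (loConn a y) (loConn b y) (ms _) (ms _)
  have hρ0 : 0 ≤ μ.real EC := measureReal_nonneg
  have hρ1 : μ.real EC ≤ 1 := (measureReal_mono (Set.subset_univ EC)).trans (le_of_eq (by simp [hμ]))
  have hay1 : μ.real Ay ≤ 1 := (measureReal_mono (Set.subset_univ Ay)).trans (le_of_eq (by simp [hμ]))
  have hbz1 : μ.real Bz ≤ 1 := (measureReal_mono (Set.subset_univ Bz)).trans (le_of_eq (by simp [hμ]))
  have hmono : μ.real (Ay ∩ Bz) ≤ μ.real Bz := measureReal_mono Set.inter_subset_right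
  rw [sahiE3_def, eXYZ, eX, eY, eZ, eYZ, eXZ, eXY]
  exact row15_threeOneCutC_ineq (μ.real EC) (μ.real (Hha ∪ Hhb)) (μ.real (Hha ∪ Hhb ∪ Hy)) (μ.real Ay) (μ.real Bz) (μ.real (Ay ∩ Bz))
    (μ.real (Ay ∩ Hy)) (μ.real (Ay ∩ (Hha ∪ Hhb ∪ Hy))) (μ.real (Bz ∩ (Hha ∪ Hhb))) (μ.real (Bz ∩ (Hha ∪ Hhb ∪ Hy)))
    (μ.real (Ay ∩ Bz ∩ Hy)) (μ.real (Ay ∩ Bz ∩ (Hha ∪ Hhb ∪ Hy))) hρ0 hρ1 hay1 hbz1 measureReal_nonneg hmono sW sBW H3 h26 h15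

end Summit.CriticalPhenomena.PercolationContinuityZ3.Theorems.FrontierDecRows

end
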